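import Mathlib
import Summits.Ventures.PercRepro2.Defs
import Summits.Ventures.PercRepro2.Graph
import Summits.Ventures.PercRepro2.Induced
import Summits.Ventures.PercRepro2.BHK

/-!
# The avoided part of the contraction–deletion centred BHK form is nonnegative
(blind cell PercRepro2, mine-1 g25; `proofs/MINE1-J1.md` §30(b2))

For the root `s`, avoided sets `Y ⊆ X ⊆ U` and nonnegative monotone cluster functionals `F₁, F₂`,
with `E_X[F] := E(F(C^U_s) 1_{R^U_X})` and `q_X := P(R^U_X)`, the **centred form with the larger
avoided set, centred at the means of the smaller one**,

  `E_X[F₁F₂] q_Y² − E_X[F₁] E_Y[F₂] q_Y − E_X[F₂] E_Y[F₁] q_Y + q_X E_Y[F₁] E_Y[F₂]`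
  `= q_X q_Y² · E[(F₁ − E_Y[F₁]/q_Y)(F₂ − E_Y[F₂]/q_Y) | R^U_X]`,

is nonnegative: van den Berg–Häggström–Kahn on `R_X` (`bhk_induced` with `X = Y`) gives the
covariance, and `bhk_induced` with one functional constant (`expect_mul_prob_le_of_subset`) gives the
**monotonicity of the conditional means in the avoided set**, so both displacements
`E_X[F_i]/q_X − E_Y[F_i]/q_Y` are `≤ 0` and their product is `≥ 0`.

With `Y = {h}` and `X = {h} ∪ m` this is the AVOIDED PART of the 2′CDC form (the part of
`E_{G/m}[(F₁ − c₁)(F₂ − c₂) 1_{l ↮ h}]` on `{l ↮ m}`, where the contracted and the plain clusters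
coincide): `proofs/MINE1-J1.md` §30(b2).  The complementary HIT part is unsigned (§30(c1)).
-/

namespace Summit.Ventures.PercRepro2

namespace CDCAvoid

section Main

variable {V : Type*} {E : Type*} [Fintype E] [DecidableEq E] [Fintype V] [DecidableEq V]
  {R : Type*} [CommRing R] [LinearOrder R] [IsStrictOrderedRing R]

/-- **Monotonicity of the conditional means in the avoided set** (cleared form): for `Y ⊆ X ⊆ U`
and a nonnegative monotone cluster functional `F`,
`E(F 1_{R_X}) · P(R_Y) ≤ E(F 1_{R_Y}) · P(R_X)` — `bhk_induced` with the second functional `1`. -/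
theorem expect_mul_prob_le_of_subset (p : E → R) (hp : IsProbVec p) (ends : E → Sym2 V) (s : V)
    {F : Set V → R} (hF : Monotone F) (hF0 : ∀ S, 0 ≤ F S) (U : Finset V) {X Y : Finset V}
    (hX : X ⊆ U) (hYX : Y ⊆ X) :
    expect p (clusterObs ends U s F * (REvent ends U s X).indicator 1) *
        prob p (REvent ends U s Y) ≤
      expect p (clusterObs ends U s F * (REvent ends U s Y).indicator 1) *
        prob p (REvent ends U s X) := by
  have h := bhk_induced p hp ends s hF (monotone_const (c := (1 : R))) hF0
    (fun _ => zero_le_one) U X Y hX (hYX.trans hX)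
  rw [Finset.inter_eq_right.2 hYX, Finset.union_eq_left.2 hYX] at h
  have e1 : (F * fun _ : Set V => (1 : R)) = F := funext fun S => mul_one (F S)
  rw [e1, clusterObs_one, one_mul, ← prob_eq_expect_indicator] at h
  exact h

/-- **The avoided part is nonnegative**: for `Y ⊆ X ⊆ U`,
`E_X[F₁F₂] q_Y² − E_X[F₁] E_Y[F₂] q_Y − E_X[F₂] E_Y[F₁] q_Y + q_X E_Y[F₁] E_Y[F₂] ≥ 0`
(`E_X[F] = E(F(C^U_s) 1_{R^U_X})`, `q_X = P(R^U_X)`). -/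
theorem avoidPart_nonneg (p : E → R) (hp : IsProbVec p) (ends : E → Sym2 V) (s : V)
    {F₁ F₂ : Set V → R} (hF₁ : Monotone F₁) (hF₂ : Monotone F₂) (hF₁0 : ∀ S, 0 ≤ F₁ S)
    (hF₂0 : ∀ S, 0 ≤ F₂ S) (U : Finset V) {X Y : Finset V} (hX : X ⊆ U) (hYX : Y ⊆ X) :
    0 ≤ expect p (clusterObs ends U s (F₁ * F₂) * (REvent ends U s X).indicator 1) *
          prob p (REvent ends U s Y) * prob p (REvent ends U s Y) -
        expect p (clusterObs ends U s F₁ * (REvent ends U s X).indicator 1) *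
          expect p (clusterObs ends U s F₂ * (REvent ends U s Y).indicator 1) *
          prob p (REvent ends U s Y) -
        expect p (clusterObs ends U s F₂ * (REvent ends U s X).indicator 1) *
          expect p (clusterObs ends U s F₁ * (REvent ends U s Y).indicator 1) *
          prob p (REvent ends U s Y) +
        prob p (REvent ends U s X) *
          expect p (clusterObs ends U s F₁ * (REvent ends U s Y).indicator 1) *
          expect p (clusterObs ends U s F₂ * (REvent ends U s Y).indicator 1) := by
  -- names
  set a := expect p (clusterObs ends U s (F₁ * F₂) * (REvent ends U s X).indicator 1) with ha
  set b := expect p (clusterObs ends U s F₁ * (REvent ends U s X).indicator 1) with hb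
  set o := expect p (clusterObs ends U s F₂ * (REvent ends U s X).indicator 1) with ho
  set b' := expect p (clusterObs ends U s F₁ * (REvent ends U s Y).indicator 1) with hb'
  set o' := expect p (clusterObs ends U s F₂ * (REvent ends U s Y).indicator 1) with ho'
  set q := prob p (REvent ends U s X) with hq
  set q' := prob p (REvent ends U s Y) with hq'
  -- BHK on `R_X`: `b · o ≤ a · q`
  have h1 : b * o ≤ a * q := by
    have h := bhk_induced p hp ends s hF₁ hF₂ hF₁0 hF₂0 U X X hX hX
    rwa [Finset.inter_self, Finset.union_self] at h
  -- monotone means: `b q' ≤ b' q`, `o q' ≤ o' q`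
  have h2 : b * q' ≤ b' * q := expect_mul_prob_le_of_subset p hp ends s hF₁ hF₁0 U hX hYX
  have h3 : o * q' ≤ o' * q := expect_mul_prob_le_of_subset p hp ends s hF₂ hF₂0 U hX hYX
  -- nonnegativity of everything
  have hb0 : 0 ≤ b := expect_nonneg hp (clusterObs_mul_indicator_nonneg ends U s (fun _ => hF₁0 _) _)
  have ho0 : 0 ≤ o := expect_nonneg hp (clusterObs_mul_indicator_nonneg ends U s (fun _ => hF₂0 _) _)
  have hb'0 : 0 ≤ b' :=
    expect_nonneg hp (clusterObs_mul_indicator_nonneg ends U s (fun _ => hF₁0 _) _)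
  have ho'0 : 0 ≤ o' :=
    expect_nonneg hp (clusterObs_mul_indicator_nonneg ends U s (fun _ => hF₂0 _) _)
  have hF0 : ∀ ω : Config E, 0 ≤ (F₁ * F₂) (cluster ends ω s) := fun ω =>
    mul_nonneg (hF₁0 _) (hF₂0 _)
  have ha0 : 0 ≤ a := expect_nonneg hp
    (clusterObs_mul_indicator_nonneg (F := F₁ * F₂) ends U s hF0 _)
  have hq0 : 0 ≤ q := prob_nonneg hp _
  have hq'0 : 0 ≤ q' := prob_nonneg hp _
  rcases hq0.lt_or_eq with hqpos | hq0'
  · -- `q · target ≥ (b q' − q b')(o q' − q o') ≥ 0`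
    have key : 0 ≤ q * (a * q' * q' - b * o' * q' - o * b' * q' + q * b' * o') := by
      have hprod : 0 ≤ (b' * q - b * q') * (o' * q - o * q') :=
        mul_nonneg (sub_nonneg.2 h2) (sub_nonneg.2 h3)
      have hsq : 0 ≤ q' * q' := mul_nonneg hq'0 hq'0
      nlinarith [mul_le_mul_of_nonneg_right h1 hsq, hprod]
    exact (mul_nonneg_iff_of_pos_left hqpos).1 key
  · -- `q = 0`: then `b q' = o q' = 0` and the target is `a q'² ≥ 0`
    have hbq : b * q' = 0 := le_antisymm (by rw [← hq0'] at h2; linarith) (mul_nonneg hb0 hq'0)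
    have hoq : o * q' = 0 := le_antisymm (by rw [← hq0'] at h3; linarith) (mul_nonneg ho0 hq'0)
    have e : a * q' * q' - b * o' * q' - o * b' * q' + q * b' * o' =
        a * q' * q' - o' * (b * q') - b' * (o * q') + q * b' * o' := by ring
    rw [e, hbq, hoq, ← hq0']
    simp only [mul_zero, sub_zero, zero_mul, add_zero]
    exact mul_nonneg (mul_nonneg ha0 hq'0) hq'0

end Main

end CDCAvoid

end Summit.Ventures.PercRepro2
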